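import Mathlib.Tactic.LinearCombination
import Mathlib.Tactic.Ring
import HarnessLib

/-!
# Venture HSemireg — the zero-sum fat point at N = 12 in CHARACTERISTIC 5: `x₁⁸ = 0` (THEOREM M5's exceptional prime, kernel form)

Companion of `Summits/Ventures/HSemireg/ZeroSumQuintuplePointN12.lean` and `…N12UpperBound.lean` (computation cell
`pub-hsemireg`, W3 «special fibres», seat w3-cm-1; THEOREM M5 of `widen/W3/W3-M3LOCAL-w3cm1.md` §1 at `N = 12`, and the
exceptional-prime law of `widen/W3/W3-M5-EXCEPTIONAL-w3cm1.md`). THEOREM M5 says the transversal slice `Z` of the zero-sum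
scheme `Y(4;9)` at `P₀ = z¹² − 1` is `Spec K[t]/(t⁵)` away from an explicit finite set of primes; its obstruction constant
`c(N) = −(N−3)(N−6)(N²−6N+3)/(20N⁵)` has `c(12) = −5/6144 ≡ 0 (mod 5)`, so `p = 5` is exceptional at `N = 12`, and there the
weight-8 constant `d₈(12) = −59/2²¹` (a 5-adic unit) takes over: the fat point is `K[t]/(t⁸)`. The companion file
`ZeroSumQuintuplePointN12.lean` (iii) exhibits the splitting of `z¹² − 6t²z² − 4tz − 1` over `𝔽₅[t]/(t⁸)` (length ≥ 8 in
characteristic 5). This file is the matching UPPER bound.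

THEOREM (`x1_pow_eight_eq_zero`). In any commutative ring of characteristic 5 (`(5 : R) = 0`), the nine slice equations in
μ₄-eigencoordinates (the right-hand sides of `ZeroSumQuintuplePointN12.dict_z10 … dict_z0`, verbatim) force `x₀ = 0`,
`y₀ = 0` and `x₁⁸ = 0`. With the seven invertible linear parts `±4·(x₀, y₀, x₃, y₃, x₂, y₂, y₁)` (`4 = −1` is a unit in
characteristic 5) Nakayama gives `𝔪 = (x₁)` in the local ring at `P₀`, hence length ≤ 8; with the companion's splitting,
length EXACTLY 8 over every field of characteristic 5 (three lines of commutative algebra, NOT formalised here).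

HOW THE KERNEL CHECKS IT. One INTEGER identity `Σᵢ Tᵢ·Fᵢ' = x₁⁸ + 5·G` in the seven generators with `x₀ = y₀ = 0`
substituted (`cert_char_five`; `Tᵢ` with 573 terms and coefficients in {±1, ±2}, `G` with 419 terms, total degree ≤ 11 —
found by exact linear algebra over `𝔽₅` on the degree-11 Macaulay matrix of the ℤ/12-graded system, then lifted to ℤ and the
multiple of 5 collected exactly). No separator is needed: over `𝔽₅` the GLOBAL scheme `{F = 0} ⊂ 𝔸⁸` is finite of degree
`192 = 4!·8` (the 24 conjugate orderings of `P₀`, each of length 8), so `x₁⁸` lies in the ideal itself (Singular 4.3.2, ×1;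
the kernel checks only the identity and the deduction).

HONEST FRAMING. Local commutative algebra of one explicit 0-dimensional scheme in characteristic 5 (a polynomial identity
with integer coefficients). No abelian variety, cycle, sheaf or semiregularity map appears; nothing here says that HC,
HC_CM or HC_AV holds, and nothing here is a new case of anything.
-/

universe u

namespace Summit.Ventures.HSemireg

namespace ZeroSumQuintuplePointN12CharFive

variable {R : Type u} [CommRing R]

/-! ### The integer certificate modulo 5 (generators with `x₀ = y₀ = 0` substituted) -/

/-- CERTIFICATE (characteristic 5): `x₁⁸` lies in the ideal generated by the seven non-trivial slice generators
`F₈' … F₀'` and `5`: an integer identity `Σ Tᵢ·Fᵢ' = x₁⁸ + 5·G` (573 + 419 terms, degree ≤ 11). -/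
theorem cert_char_five (x₁ x₂ x₃ y₁ y₂ y₃ : R) (h5 : (5 : R) = 0)
    (F8 : (-2) * x₂^2 + (-4) * x₁ * x₃ = 0)
    (F7 : (-4) * x₃ * y₁ + (-4) * x₂ * y₂ + (-4) * x₁ * y₃ + (-4) * x₃ = 0)
    (F6 : (4) * x₂ * x₃^2 + (4) * x₁^2 * x₂ + (-2) * y₂^2 + (-4) * y₁ * y₃ + (-4) * y₃ = 0)
    (F5 : (4) * x₃^2 * y₂ + (8) * x₂ * x₃ * y₃ + (8) * x₁ * x₂ * y₁ + (4) * x₁^2 * y₂ + (8) * x₁ * x₂ = 0)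
    (F4 : (-(x₃^4)) + x₂^4 + (-4) * x₁ * x₂^2 * x₃ + (2) * x₁^2 * x₃^2 + (-(x₁^4)) + (8) * x₃ * y₂ * y₃
      + (4) * x₂ * y₃^2 + (4) * x₂ * y₁^2 + (8) * x₁ * y₁ * y₂ + (8) * x₂ * y₁ + (8) * x₁ * y₂
      + (4) * x₂ = 0)
    (F3 : (-4) * x₃^3 * y₃ + (-4) * x₂^2 * x₃ * y₁ + (4) * x₂^3 * y₂ + (4) * x₁ * x₃^2 * y₁
      + (-8) * x₁ * x₂ * x₃ * y₂ + (-4) * x₁ * x₂^2 * y₃ + (4) * x₁^2 * x₃ * y₃ + (-4) * x₁^3 * y₁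
      + (4) * y₂ * y₃^2 + (4) * y₁^2 * y₂ + (-4) * x₂^2 * x₃ + (4) * x₁ * x₃^2 + (-4) * x₁^3
      + (8) * y₁ * y₂ + (4) * y₂ = 0)
    (F0 : (-(y₃^4)) + y₂^4 + (-4) * y₁ * y₂^2 * y₃ + (2) * y₁^2 * y₃^2 + (-(y₁^4)) + (-4) * y₂^2 * y₃
      + (4) * y₁ * y₃^2 + (-4) * y₁^3 + (2) * y₃^2 + (-6) * y₁^2 + (-4) * y₁ = 0) :
    x₁ ^ 8 = 0 := by
  linear_combination ((-2) * x₃^3 * y₁ * y₂ * y₃^4 + (-2) * x₃^3 * y₁ * y₂^5 + (-(x₃^3 * y₁^3 * y₂ * y₃^2)) + (-(x₃^3 * y₁^5 * y₂)) + (-(x₃^6 * y₃^3))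
        + (-(x₃^6 * y₁ * y₂^2)) + x₃^6 * y₁^2 * y₃ + (-2) * x₂ * x₃^2 * y₁ * y₂^4 * y₃ + (-(x₂ * x₃^2 * y₁^2 * y₂^2 * y₃^2))
        + (-(x₂ * x₃^2 * y₁^5 * y₃)) + (2) * x₂^2 * x₃ * y₂^5 * y₃ + (-(x₂^2 * x₃ * y₁ * y₂^3 * y₃^2)) + x₂^2 * x₃ * y₁^2 * y₂ * y₃^3
        + (-(x₂^2 * x₃ * y₁^3 * y₂^3)) + (-(x₂^2 * x₃ * y₁^4 * y₂ * y₃)) + (-2) * x₂^2 * x₃^4 * y₁^3 + (-2) * x₂^3 * y₁ * y₂^2 * y₃^3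
        + (-(x₂^3 * y₁^3 * y₂^2 * y₃)) + x₂^3 * y₁^4 * y₃^2 + (-(x₂^3 * y₁^6)) + (-2) * x₂^3 * x₃^3 * y₁^2 * y₂ + x₁ * x₃^2 * y₂^5 * y₃
        + (2) * x₁ * x₃^2 * y₁ * y₂^3 * y₃^2 + (-2) * x₁ * x₃^2 * y₁^2 * y₂ * y₃^3 + (-(x₁ * x₃^2 * y₁^3 * y₂^3)) + (-(x₁ * x₃^2 * y₁^4 * y₂ * y₃))
        + (-(x₁ * x₃^5 * y₁^3)) + (-2) * x₁ * x₂ * x₃ * y₂^4 * y₃^2 + (2) * x₁ * x₂ * x₃ * y₁ * y₂^2 * y₃^3 + (-(x₁ * x₂ * x₃ * y₁^2 * y₃^4))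
        + (2) * x₁ * x₂ * x₃ * y₁^3 * y₂^2 * y₃ + x₁ * x₂ * x₃ * y₁^4 * y₃^2 + x₁ * x₂ * x₃ * y₁^6 + (-2) * x₁ * x₂ * x₃^4 * y₁^2 * y₂
        + (2) * x₁ * x₂^2 * y₂^3 * y₃^3 + (2) * x₁ * x₂^2 * y₁ * y₂ * y₃^4 + x₁ * x₂^2 * y₁^3 * y₂ * y₃^2 + (2) * x₁ * x₂^2 * y₁^5 * y₂
        + (2) * x₁ * x₂^2 * x₃^3 * y₃^3 + (-(x₁^2 * x₃ * y₂^3 * y₃^3)) + (-(x₁^2 * x₃ * y₁ * y₂ * y₃^4)) + (2) * x₁^2 * x₃ * y₁ * y₂^5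
        + (-(x₁^2 * x₃ * y₁^2 * y₂^3 * y₃)) + (-2) * x₁^2 * x₃ * y₁^3 * y₂ * y₃^2 + (-(x₁^2 * x₃ * y₁^5 * y₂)) + (2) * x₁^2 * x₃^4 * y₃^3
        + (-(x₁^2 * x₃^4 * y₁ * y₂^2)) + x₁^2 * x₃^4 * y₁^2 * y₃ + (2) * x₁^2 * x₂ * y₂^6 + (-(x₁^2 * x₂ * y₁ * y₃^5)) + x₁^2 * x₂ * y₁ * y₂^4 * y₃
        + (-2) * x₁^2 * x₂ * y₁^2 * y₂^2 * y₃^2 + (-2) * x₁^2 * x₂ * y₁^3 * y₃^3 + x₁^2 * x₂ * y₁^4 * y₂^2 + (-2) * x₁^2 * x₂^2 * x₃^2 * y₁^3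
        + (2) * x₁^3 * y₂ * y₃^5 + x₁^3 * y₂^5 * y₃ + (2) * x₁^3 * y₁ * y₂^3 * y₃^2 + (2) * x₁^3 * y₁^2 * y₂ * y₃^3 + (-(x₁^3 * y₁^3 * y₂^3))
        + (2) * x₁^3 * y₁^4 * y₂ * y₃ + (2) * x₁^3 * x₃^3 * y₂^2 * y₃ + (-(x₁^3 * x₃^3 * y₁ * y₃^2)) + (2) * x₁^3 * x₃^3 * y₁^3
        + (-(x₁^3 * x₂ * x₃^2 * y₁^2 * y₂)) + x₁^3 * x₂^2 * x₃ * y₁ * y₂^2 + x₁^3 * x₂^3 * y₂^3 + (2) * x₁^3 * x₂^3 * y₁ * y₂ * y₃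
        + x₁^4 * x₃^2 * y₁ * y₂^2 + (-2) * x₁^4 * x₃^2 * y₁^2 * y₃ + (-2) * x₁^4 * x₂ * x₃ * y₂^3 + (-(x₁^4 * x₂ * x₃ * y₁ * y₂ * y₃))
        + (-(x₁^4 * x₂^2 * y₂^2 * y₃)) + x₁^4 * x₂^2 * y₁ * y₃^2 + x₁^4 * x₂^2 * y₁^3 + (-2) * x₁^5 * x₃ * y₂^2 * y₃ + (-(x₁^5 * x₃ * y₁ * y₃^2))
        + x₁^5 * x₃ * y₁^3 + (2) * x₁^5 * x₂ * y₂ * y₃^2 + (-(x₁^5 * x₂ * y₁^2 * y₂)) + (2) * x₁^6 * y₃^3 + (2) * x₁^6 * y₁ * y₂^2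
        + (2) * x₁^6 * y₁^2 * y₃ + (2) * y₂^8 + y₁ * y₂^2 * y₃^5 + y₁ * y₂^6 * y₃ + (-(y₁^2 * y₂^4 * y₃^2)) + (-(y₁^4 * y₃^4)) + (-2) * y₁^4 * y₂^4
        + (2) * y₁^5 * y₂^2 * y₃ + y₁^8 + x₃^3 * y₂ * y₃^4 + (-(x₃^3 * y₂^5)) + (2) * x₃^3 * y₁^4 * y₂ + x₃^6 * y₂^2 + (-2) * x₂ * x₃^2 * y₂^4 * y₃
        + (-(x₂ * x₃^2 * y₁^4 * y₃)) + (-2) * x₂^2 * x₃^4 * y₁^2 + x₂^3 * y₁ * y₂^4 + x₂^3 * y₁^3 * y₃^2 + (-2) * x₂^3 * y₁^5 + x₁ * x₃^2 * y₂^3 * y₃^2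
        + x₁ * x₃^2 * y₁ * y₂ * y₃^3 + x₁ * x₃^2 * y₁^2 * y₂^3 + (2) * x₁ * x₃^2 * y₁^3 * y₂ * y₃ + (-(x₁ * x₃^5 * y₁^2))
        + (-(x₁ * x₂ * x₃ * y₁ * y₃^4)) + (2) * x₁ * x₂ * x₃ * y₁ * y₂^4 + (-(x₁ * x₂ * x₃ * y₁^3 * y₃^2)) + (2) * x₁ * x₂ * x₃ * y₁^5
        + (2) * x₁ * x₂^2 * y₂^5 + (-2) * x₁ * x₂^2 * y₁^2 * y₂ * y₃^2 + (-2) * x₁ * x₂^2 * y₁^4 * y₂ + x₁^2 * x₃ * y₂^5 + x₁^2 * x₃ * y₁ * y₂^3 * y₃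
        + (-(x₁^2 * x₃ * y₁^2 * y₂ * y₃^2)) + x₁^2 * x₃ * y₁^4 * y₂ + x₁^2 * x₃^4 * y₂^2 + (-2) * x₁^2 * x₂ * y₂^4 * y₃
        + (-2) * x₁^2 * x₂ * y₁ * y₂^2 * y₃^2 + (2) * x₁^2 * x₂ * y₁^2 * y₃^3 + x₁^2 * x₂ * y₁^3 * y₂^2 + (-2) * x₁^2 * x₂^2 * x₃^2 * y₁^2
        + (-2) * x₁^3 * y₂^3 * y₃^2 + (-2) * x₁^3 * y₁ * y₂ * y₃^3 + (-2) * x₁^3 * y₁^2 * y₂^3 + (-(x₁^3 * y₁^3 * y₂ * y₃)) + x₁^3 * x₃^3 * y₁^2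
        + (-(x₁^3 * x₂ * x₃^2 * y₁ * y₂)) + (-2) * x₁^4 * x₃^2 * y₂^2 + x₁^4 * x₃^2 * y₁ * y₃ + (2) * x₁^4 * x₂ * x₃ * y₂ * y₃ + (-(x₁^4 * x₂^2 * y₁^2))
        + (2) * x₁^5 * x₂ * y₁ * y₂ + (-(x₁^6 * y₂^2)) + (-(x₁^6 * y₁ * y₃)) + (-2) * y₁ * y₂^4 * y₃^2 + (2) * y₁^2 * y₂^2 * y₃^3 + (-(y₁^3 * y₃^4))
        + y₁^3 * y₂^4 + (-2) * y₁^4 * y₂^2 * y₃ + (-(y₁^5 * y₃^2)) + (-(y₁^7)) + (-2) * x₁ * x₃^2 * y₂ * y₃^3 + (-(x₁ * x₃^2 * y₁ * y₂^3))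
        + (-(x₁ * x₃^2 * y₁^2 * y₂ * y₃)) + (-2) * x₁ * x₃^5 * y₁ + (-2) * x₁ * x₂ * x₃ * y₂^4 + (2) * x₁ * x₂ * x₃ * y₁^2 * y₃^2
        + x₁ * x₂^2 * y₁^3 * y₂ + (-(x₁^2 * x₃ * y₂^3 * y₃)) + (-(x₁^2 * x₃ * y₁ * y₂ * y₃^2)) + x₁^2 * x₃ * y₁^3 * y₂ + (2) * x₁^2 * x₃^4 * y₃
        + (-2) * x₁^2 * x₂ * y₁^2 * y₂^2 + (2) * x₁^3 * y₂ * y₃^3 + (-(x₁^3 * y₁^2 * y₂ * y₃)) + (-(x₁^4 * x₃^2 * y₃)) + (-2) * x₁^4 * x₂^2 * y₁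
        + x₁^6 * y₃ + (-2) * y₂^4 * y₃^2 + (-2) * y₁ * y₂^2 * y₃^3 + y₁^2 * y₂^4 + (2) * y₁^4 * y₃^2 + (2) * x₃^3 * y₁^2 * y₂ + (2) * x₁ * x₃^2 * y₂^3
        + (-2) * x₁ * x₃^5 + (-2) * x₁^2 * x₃ * y₂ * y₃^2 + (2) * x₁^2 * x₃ * y₁^2 * y₂ + (2) * x₁^2 * x₂ * y₁ * y₂^2 + (-2) * x₁^3 * y₂^3
        + x₁^3 * y₁ * y₂ * y₃ + (2) * x₁^4 * x₂^2 + (-2) * x₁^5 * x₃ + (-(y₁ * y₂^4)) + (2) * y₁^2 * y₂^2 * y₃ + (-(y₁^3 * y₃^2)) + (2) * y₁^5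
        + x₁ * x₃^2 * y₂ * y₃ + (-2) * x₁^2 * x₃ * y₁ * y₂ + (-2) * x₁^2 * x₂ * y₂^2 + (-2) * y₂^4 + y₁ * y₂^2 * y₃ + (-(x₃^3 * y₂))
        + (-(x₁^2 * x₃ * y₂)) + (2) * y₂^2 * y₃ + (-(x₂^3)) + x₁ * x₂ * x₃ + y₃^2 + y₁^2 + (2) * y₁ + (1)) * F8
      + (x₃^4 * y₂^3 * y₃^2 + (-2) * x₃^4 * y₁ * y₂ * y₃^3 + (-2) * x₃^4 * y₁^3 * y₂ * y₃ + x₃^7 * y₁^2 + (2) * x₂ * x₃^3 * y₁ * y₃^4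
        + x₂ * x₃^3 * y₁ * y₂^4 + x₂ * x₃^3 * y₁^3 * y₃^2 + (-(x₂ * x₃^3 * y₁^5)) + (-2) * x₂ * x₃^6 * y₁ * y₂ + x₁ * x₃^3 * y₂^5
        + (-(x₁ * x₃^3 * y₁^2 * y₂ * y₃^2)) + x₁ * x₃^3 * y₁^4 * y₂ + (-(x₁ * x₃^6 * y₂^2)) + (-(x₁ * x₂ * x₃^2 * y₂^4 * y₃))
        + (-2) * x₁ * x₂ * x₃^2 * y₁^2 * y₃^3 + (2) * x₁ * x₂ * x₃^2 * y₁^3 * y₂^2 + x₁ * x₂ * x₃^2 * y₁^4 * y₃ + (-2) * x₁ * x₂ * x₃^5 * y₂ * y₃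
        + x₁^2 * x₃^2 * y₁ * y₂ * y₃^3 + (2) * x₁^2 * x₃^2 * y₁^2 * y₂^3 + (-2) * x₁^2 * x₃^5 * y₁^2 + (2) * x₁^2 * x₂ * x₃ * y₂^2 * y₃^3
        + (-2) * x₁^2 * x₂ * x₃ * y₁ * y₂^4 + (-2) * x₁^2 * x₂ * x₃ * y₁^2 * y₂^2 * y₃ + (-(x₁^2 * x₂ * x₃ * y₁^3 * y₃^2)) + x₁^2 * x₂ * x₃ * y₁^5
        + x₁^2 * x₂ * x₃^4 * y₁ * y₂ + (-(x₁^3 * x₃ * y₂ * y₃^4)) + (2) * x₁^3 * x₃ * y₂^5 + (2) * x₁^3 * x₃ * y₁ * y₂^3 * y₃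
        + (-(x₁^3 * x₃ * y₁^2 * y₂ * y₃^2)) + (-2) * x₁^3 * x₃ * y₁^4 * y₂ + (-(x₁^3 * x₃^4 * y₂^2)) + (-(x₁^3 * x₃^4 * y₁ * y₃))
        + (2) * x₁^3 * x₂ * y₃^5 + (2) * x₁^3 * x₂ * y₂^4 * y₃ + x₁^3 * x₂ * y₁ * y₂^2 * y₃^2 + (-(x₁^3 * x₂ * y₁^2 * y₃^3))
        + (-(x₁^3 * x₂ * y₁^3 * y₂^2)) + x₁^3 * x₂ * y₁^4 * y₃ + (2) * x₁^3 * x₂ * x₃^3 * y₂ * y₃ + (-(x₁^4 * y₂^3 * y₃^2)) + (-(x₁^4 * y₁ * y₂ * y₃^3))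
        + (-(x₁^4 * y₁^2 * y₂^3)) + (2) * x₁^4 * y₁^3 * y₂ * y₃ + (-(x₁^4 * x₃^3 * y₃^2)) + x₁^4 * x₃^3 * y₁^2 + x₁^4 * x₂ * x₃^2 * y₁ * y₂
        + (-(x₁^5 * x₃^2 * y₂^2)) + (-(x₁^5 * x₃^2 * y₁ * y₃)) + (-(x₁^5 * x₂ * x₃ * y₂ * y₃)) + (-2) * x₁^6 * x₃ * y₃^2 + (-2) * x₁^6 * x₃ * y₁^2
        + (-2) * x₁^6 * x₂ * y₁ * y₂ + (-(x₁^7 * y₂^2)) + (2) * x₁^7 * y₁ * y₃ + (-2) * x₃ * y₂^4 * y₃^3 + x₃ * y₁ * y₂^2 * y₃^4 + x₃ * y₁ * y₂^6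
        + (-2) * x₃ * y₁^2 * y₂^4 * y₃ + (-(x₃ * y₁^3 * y₂^2 * y₃^2)) + (-(x₃ * y₁^5 * y₂^2)) + x₃^4 * y₂ * y₃^3 + x₃^4 * y₁^2 * y₂ * y₃
        + (-(x₂ * y₂^7)) + (-2) * x₂ * y₁ * y₂ * y₃^5 + (2) * x₂ * y₁ * y₂^5 * y₃ + (-2) * x₂ * y₁^2 * y₂^3 * y₃^2 + (-(x₂ * y₁^3 * y₂ * y₃^3))
        + x₂ * y₁^4 * y₂^3 + (2) * x₂ * y₁^5 * y₂ * y₃ + (2) * x₂ * x₃^3 * y₃^4 + (-2) * x₂ * x₃^3 * y₂^4 + (-(x₂ * x₃^3 * y₁^2 * y₃^2))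
        + (2) * x₂ * x₃^6 * y₂ + x₁ * y₂^2 * y₃^5 + (2) * x₁ * y₂^6 * y₃ + (-2) * x₁ * y₁ * y₃^6 + (-(x₁ * y₁ * y₂^4 * y₃^2)) + x₁ * y₁^2 * y₂^2 * y₃^3
        + x₁ * y₁^4 * y₂^2 * y₃ + (-(x₁ * y₁^7)) + (-2) * x₁ * x₃^3 * y₁^3 * y₂ + (2) * x₁ * x₂ * x₃^2 * y₂^2 * y₃^2 + (2) * x₁ * x₂ * x₃^2 * y₁ * y₃^3
        + (2) * x₁ * x₂ * x₃^2 * y₁^2 * y₂^2 + (-2) * x₁ * x₂ * x₃^2 * y₁^3 * y₃ + x₁^2 * x₃^2 * y₂ * y₃^3 + (-2) * x₁^2 * x₃^2 * y₁ * y₂^3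
        + (2) * x₁^2 * x₂ * x₃ * y₂^4 + (2) * x₁^2 * x₂ * x₃ * y₁ * y₂^2 * y₃ + x₁^2 * x₂ * x₃ * y₁^2 * y₃^2 + (-2) * x₁^2 * x₂ * x₃ * y₁^4
        + x₁^3 * x₃ * y₂^3 * y₃ + (-(x₁^3 * x₃ * y₁ * y₂ * y₃^2)) + x₁^3 * x₃ * y₁^3 * y₂ + x₁^3 * x₃^4 * y₃ + (-2) * x₁^3 * x₂ * y₂^2 * y₃^2
        + (-2) * x₁^3 * x₂ * y₁ * y₃^3 + (-2) * x₁^3 * x₂ * y₁^2 * y₂^2 + (-(x₁^4 * y₂ * y₃^3)) + (2) * x₁^4 * x₃^3 * y₁ + x₁^4 * x₂ * x₃^2 * y₂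
        + (2) * x₁^5 * x₃^2 * y₃ + x₁^6 * x₂ * y₂ + x₃ * y₂^6 + (-2) * x₃ * y₁ * y₂^4 * y₃ + x₃ * y₁^4 * y₂^2 + (-2) * x₂ * y₁ * y₂^3 * y₃^2
        + x₂ * y₁^2 * y₂ * y₃^3 + (-(x₂ * y₁^3 * y₂^3)) + (2) * x₂ * y₁^4 * y₂ * y₃ + (-2) * x₂ * x₃^3 * y₁^3 + (-2) * x₁ * y₂^4 * y₃^2
        + x₁ * y₁^4 * y₃^2 + (2) * x₁ * y₁^6 + (-(x₁ * x₃^3 * y₁^2 * y₂)) + x₁ * x₂ * x₃^2 * y₃^3 + (-2) * x₁ * x₂ * x₃^2 * y₁ * y₂^2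
        + (-2) * x₁^2 * x₃^2 * y₂^3 + x₁^2 * x₃^2 * y₁ * y₂ * y₃ + (2) * x₁^2 * x₃^5 + (-2) * x₁^2 * x₂ * x₃ * y₂^2 * y₃
        + (-(x₁^2 * x₂ * x₃ * y₁ * y₃^2)) + (-2) * x₁^3 * x₃ * y₂ * y₃^2 + (2) * x₁^3 * x₂ * y₃^3 + (-(x₁^3 * x₂ * y₁ * y₂^2))
        + (2) * x₁^3 * x₂ * y₁^2 * y₃ + (-(x₁^4 * y₂^3)) + (2) * x₁^4 * y₁ * y₂ * y₃ + (-(x₁^4 * x₃^3)) + (-(x₁^6 * x₃)) + (-2) * x₃ * y₂^4 * y₃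
        + x₃ * y₁ * y₂^2 * y₃^2 + x₂ * y₂^3 * y₃^2 + (2) * x₂ * y₁ * y₂ * y₃^3 + x₂ * y₁^2 * y₂^3 + (-2) * x₂ * y₁^3 * y₂ * y₃ + (-2) * x₁ * y₂^2 * y₃^3
        + (-(x₁ * y₁ * y₂^4)) + x₁ * y₁^2 * y₂^2 * y₃ + (2) * x₁ * y₁^3 * y₃^2 + (-2) * x₁ * y₁^5 + (-(x₁ * x₃^3 * y₁ * y₂))
        + (-(x₁ * x₂ * x₃^2 * y₂^2)) + (-2) * x₁ * x₂ * x₃^2 * y₁ * y₃ + (-(x₁^2 * x₃^2 * y₂ * y₃)) + (-2) * x₁^2 * x₂ * x₃ * y₃^2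
        + (-2) * x₁^2 * x₂ * x₃ * y₁^2 + (-2) * x₁^3 * x₃ * y₁ * y₂ + (-2) * x₁^3 * x₂ * y₂^2 + (-2) * x₁^3 * x₂ * y₁ * y₃ + x₁^4 * y₂ * y₃
        + (-(x₃ * y₁^2 * y₂^2)) + (-(x₂ * y₁^2 * y₂ * y₃)) + (2) * x₁ * y₂^4 + x₁ * y₁^2 * y₃^2 + x₁ * x₃^3 * y₂ + (2) * x₁ * x₂ * x₃^2 * y₃
        + (-2) * x₁^2 * x₂ * x₃ * y₁ + x₁^3 * x₃ * y₂ + (-2) * x₁^3 * x₂ * y₃ + (-(x₃ * y₁ * y₂^2)) + x₂ * y₂^3 + (2) * x₂ * y₁ * y₂ * y₃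
        + (-2) * x₂ * x₃^3 + (-(x₁ * y₂^2 * y₃)) + x₁ * y₁ * y₃^2 + (-(x₁^2 * x₂ * x₃)) + (-(x₃ * y₂^2)) + (-(x₂ * y₂ * y₃)) + (-(x₁ * y₃^2))
        + (-(x₁ * y₁)) + (-(x₁))) * F7
      + ((2) * x₃^2 * y₂^4 * y₃^2 + x₃^2 * y₁ * y₂^2 * y₃^3 + (2) * x₃^2 * y₁^2 * y₂^4 + (2) * x₃^2 * y₁^3 * y₂^2 * y₃ + x₃^5 * y₁^2 * y₂
        + x₂ * x₃ * y₁ * y₂ * y₃^4 + x₂ * x₃ * y₁^5 * y₂ + (2) * x₂ * x₃^4 * y₃^3 + (-(x₂ * x₃^4 * y₁^2 * y₃)) + x₁ * x₃ * y₂^6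
        + (2) * x₁ * x₃ * y₁ * y₃^5 + x₁ * x₃ * y₁^3 * y₃^3 + x₁ * x₃ * y₁^4 * y₂^2 + (-2) * x₁ * x₂ * y₂ * y₃^5 + x₁ * x₂ * y₂^5 * y₃
        + x₁ * x₂ * y₁^3 * y₂^3 + x₁ * x₂ * y₁^4 * y₂ * y₃ + (-2) * x₁^2 * y₂^4 * y₃^2 + (-(x₁^2 * y₁ * y₂^2 * y₃^3)) + (-(x₁^2 * y₁^2 * y₃^4))
        + (-2) * x₁^2 * y₁^4 * y₃^2 + x₁^2 * y₁^6 + (2) * x₁^3 * x₂ * x₃ * y₂^2 * y₃ + x₁^3 * x₂ * x₃ * y₁ * y₃^2 + (-2) * x₁^3 * x₂ * x₃ * y₁^3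
        + (-(x₁^4 * x₃ * y₂ * y₃^2)) + x₁^4 * x₃ * y₁^2 * y₂ + x₁^4 * x₂ * y₃^3 + (2) * x₁^4 * x₂ * y₁ * y₂^2 + (-2) * x₁^4 * x₂ * y₁^2 * y₃
        + x₁^5 * y₂^3 + x₁^5 * y₁ * y₂ * y₃ + (-(x₃^2 * y₁^2 * y₂^2 * y₃)) + (-(x₁ * x₃ * y₁ * y₂^2 * y₃^2)) + (2) * x₁ * x₂ * y₁^3 * y₂ * y₃
        + (2) * x₁^2 * y₂^2 * y₃^3 + (2) * x₁^2 * y₁ * y₃^4 + (2) * x₁^2 * y₁^2 * y₂^2 * y₃ + (2) * x₁^2 * y₁^3 * y₃^2 + x₁^4 * x₂ * y₂^2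
        + (2) * x₁^4 * x₂ * y₁ * y₃ + (-2) * x₁^5 * y₂ * y₃ + x₂ * x₃ * y₁^3 * y₂ + x₂ * x₃^4 * y₃ + (-2) * x₁^2 * y₃^4 + (2) * x₁^2 * y₂^4
        + (-(x₁^2 * y₁ * y₂^2 * y₃)) + (2) * x₁^4 * x₂ * y₃ + (-2) * x₁ * x₃ * y₁^2 * y₃ + x₁ * x₂ * y₁ * y₂ * y₃ + (2) * x₁^2 * y₁ + x₁^2) * F6
      + ((-2) * x₃^3 * y₁ * y₂^2 * y₃^2 + (-2) * x₃^3 * y₁^2 * y₃^3 + (2) * x₃^3 * y₁^3 * y₂^2 + (2) * x₃^3 * y₁^4 * y₃ + (2) * x₂ * x₃^5 * y₁^2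
        + (2) * x₁ * x₃^2 * y₂^2 * y₃^3 + (-(x₁ * x₃^2 * y₁ * y₃^4)) + (-(x₁ * x₃^2 * y₁ * y₂^4)) + (-(x₁ * x₃^2 * y₁^3 * y₃^2)) + x₁ * x₃^2 * y₁^5
        + (-2) * x₁ * x₃^5 * y₁ * y₂ + x₁ * x₂ * x₃ * y₂ * y₃^4 + (-(x₁ * x₂ * x₃ * y₁ * y₂^3 * y₃)) + x₁ * x₂ * x₃ * y₁^2 * y₂ * y₃^2
        + (-2) * x₁ * x₂ * x₃ * y₁^4 * y₂ + (-(x₁ * x₂ * x₃^4 * y₂^2)) + (-2) * x₁^2 * x₃ * y₂^4 * y₃ + (-2) * x₁^2 * x₃ * y₁ * y₂^2 * y₃^2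
        + x₁^2 * x₃ * y₁^2 * y₃^3 + (-(x₁^2 * x₃^4 * y₂ * y₃)) + (2) * x₁^2 * x₂ * y₁ * y₂ * y₃^3 + (2) * x₁^2 * x₂ * y₁^3 * y₂ * y₃
        + x₁^2 * x₂ * x₃^3 * y₁^2 + (-2) * x₁^3 * y₁ * y₃^4 + x₁^3 * y₁^2 * y₂^2 * y₃ + x₁^3 * y₁^3 * y₃^2 + (-2) * x₁^3 * x₂ * x₃^2 * y₂^2
        + (-2) * x₁^3 * x₂ * x₃^2 * y₁ * y₃ + (2) * x₁^4 * x₃^2 * y₂ * y₃ + (2) * x₁^4 * x₂ * x₃ * y₃^2 + (-2) * x₁^5 * x₃ * y₁ * y₂ + x₁^5 * x₂ * y₂^2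
        + (2) * x₁^6 * y₂ * y₃ + y₂^5 * y₃^2 + (2) * y₁ * y₂^3 * y₃^3 + y₁^2 * y₂ * y₃^4 + (2) * y₁^2 * y₂^5 + (2) * y₁^4 * y₂ * y₃^2 + (-(y₁^6 * y₂))
        + x₃^3 * y₂^2 * y₃^2 + (-(x₃^3 * y₁ * y₃^3)) + (-2) * x₃^3 * y₁^2 * y₂^2 + (-2) * x₃^3 * y₁^3 * y₃ + (-(x₁ * x₃^2 * y₃^4))
        + (-2) * x₁^2 * x₃ * y₁^2 * y₂^2 + (-(x₁^2 * x₂ * y₂ * y₃^3)) + x₁^3 * y₃^4 + (2) * x₁^3 * y₂^4 + (-2) * x₁^5 * x₂ * y₃ + (2) * y₁ * y₂ * y₃^4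
        + (2) * y₁ * y₂^5 + y₁^3 * y₂ * y₃^2 + x₃^3 * y₃^3 + (2) * x₂ * x₃^5 + x₁ * x₂ * x₃ * y₁^2 * y₂ + x₁^2 * x₃ * y₁^2 * y₃
        + (-2) * x₁^3 * y₂^2 * y₃ + (-(x₁^3 * y₁^3)) + y₂^5 + y₁ * y₂^3 * y₃ + (-2) * y₁^2 * y₂ * y₃^2 + y₁^4 * y₂ + x₁ * x₂ * x₃ * y₁ * y₂
        + x₁^2 * x₂ * y₂ * y₃ + (-(x₁^3 * y₁^2)) + (-2) * y₂^3 * y₃ + y₁ * y₂ * y₃^2 + (-(y₁^3 * y₂)) + (2) * x₁^3 * y₁ + (-2) * y₁^2 * y₂ + x₁^3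
        + (-2) * y₁ * y₂ + (-(y₂))) * F5
      + ((-2) * x₃ * y₁ * y₂^3 * y₃^2 + (2) * x₃ * y₁^2 * y₂ * y₃^3 + (-2) * x₃ * y₁^3 * y₂^3 + x₃ * y₁^4 * y₂ * y₃ + x₃^4 * y₁^3
        + x₂ * y₁ * y₂^2 * y₃^3 + (-2) * x₂ * y₁^3 * y₂^2 * y₃ + (2) * x₂ * y₁^4 * y₃^2 + (-2) * x₂ * y₁^6 + x₂ * x₃^3 * y₁^2 * y₂
        + (-(x₁ * y₂^3 * y₃^3)) + (2) * x₁ * y₁ * y₂ * y₃^4 + (-2) * x₁ * y₁^3 * y₂ * y₃^2 + (-(x₁ * y₁^5 * y₂)) + (-(x₁ * x₃^3 * y₃^3))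
        + x₁^2 * x₃^2 * y₁^3 + (2) * x₁^3 * x₂ * y₂^3 + (-(x₁^3 * x₂ * y₁ * y₂ * y₃)) + (2) * x₁^4 * y₂^2 * y₃ + (2) * x₁^4 * y₁ * y₃^2
        + (2) * x₁^4 * y₁^3 + x₃^4 * y₁^2 + (2) * x₂ * y₁ * y₂^4 + (2) * x₂ * y₁^3 * y₃^2 + x₂ * y₁^5 + x₁ * y₁^4 * y₂ + x₁^2 * x₃^2 * y₁^2
        + (-2) * x₁^4 * y₁^2 + (2) * x₁ * y₁^3 * y₂ + x₁^4 * y₁ + (-(x₁^4)) + (-2) * x₂) * F4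
      + ((2) * x₃^2 * y₁^2 * y₂ * y₃^2 + x₂ * x₃ * y₂^4 * y₃ + (-2) * x₂ * x₃ * y₁^4 * y₃ + (-2) * x₁ * x₃ * y₁^3 * y₂ * y₃ + (-2) * x₁ * x₃^4 * y₁^2
        + (-2) * x₁ * x₂ * y₁ * y₃^4 + x₁ * x₂ * y₁^3 * y₃^2 + x₁^2 * y₂^5 + (-2) * x₁^2 * y₁ * y₂^3 * y₃ + (-(x₁^2 * y₁^2 * y₂ * y₃^2))
        + (-2) * x₁^2 * y₁^4 * y₂ + (-2) * x₁^3 * x₂ * x₃ * y₁ * y₂ + (2) * x₁^4 * x₃ * y₂^2 + (-(x₁^4 * x₂ * y₂ * y₃)) + (2) * x₁^5 * y₁^2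
        + x₁ * x₂ * y₂^4 + (-(x₁ * x₂ * y₁^2 * y₃^2)) + (-(x₁^2 * y₁ * y₂ * y₃^2)) + (-2) * x₁^2 * y₁^3 * y₂ + x₁^5 * y₁ + (-(x₁^2 * y₁^2 * y₂))
        + x₁^2 * y₁ * y₂ + (-(x₁^2 * y₂))) * F3
      + (x₂ * x₃^4 * y₁^2 + x₁^3 * x₃^2 * y₁ * y₂ + x₁^4 * x₃ * y₂ * y₃ + (2) * x₁^4 * x₂ * y₃^2 + x₁^4 * x₂ * y₁^2 + (-(x₁^5 * y₁ * y₂))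
        + (-2) * x₂ * x₃^4 * y₁ + x₁ * x₂ * y₂^3 * y₃ + (-(x₁ * x₂ * y₁ * y₂ * y₃^2)) + x₁ * x₂ * y₁^3 * y₂ + x₁^2 * y₂^2 * y₃^2
        + (-2) * x₁^2 * y₁ * y₃^3 + (-2) * x₁^2 * y₁^2 * y₂^2 + (-2) * x₁^4 * x₂ * y₁ + (-2) * x₁^5 * y₂ + (2) * x₂ * x₃^4 + x₁ * x₃ * y₂^2 * y₃
        + (-2) * x₁ * x₂ * y₂ * y₃^2 + (-2) * x₁ * x₂ * y₁^2 * y₂ + (-(x₁^2 * y₁ * y₂^2)) + (-2) * x₁^2 * y₁^2 * y₃ + (2) * x₁^4 * x₂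
        + (-2) * x₁ * x₂ * y₁ * y₂ + x₁^2 * y₂^2 + x₁^2 * y₁ * y₃ + x₁ * x₂ * y₂ + (-2) * x₁^2 * y₃) * F0
      + ((2) * x₃^5 * y₁ * y₂^3 * y₃^2 + (2) * x₃^5 * y₁^2 * y₂ * y₃^3 + (-2) * x₃^5 * y₁^3 * y₂^3 + (-3) * x₃^5 * y₁^4 * y₂ * y₃ + x₃^8 * y₁^3
        + x₂ * x₃^4 * y₁ * y₂^2 * y₃^3 + (5) * x₂ * x₃^4 * y₁^2 * y₃^4 + (-(x₂ * x₃^4 * y₁^2 * y₂^4)) + (-6) * x₂ * x₃^4 * y₁^3 * y₂^2 * y₃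
        + (-4) * x₂ * x₃^4 * y₁^4 * y₃^2 + (-(x₂ * x₃^4 * y₁^6)) + (-3) * x₂ * x₃^7 * y₁^2 * y₂ + (2) * x₂^2 * x₃^3 * y₁^3 * y₂ * y₃^2
        + (-2) * x₂^2 * x₃^3 * y₁^5 * y₂ + (-2) * x₂^2 * x₃^6 * y₃^3 + (-2) * x₂^2 * x₃^6 * y₁ * y₂^2 + (-2) * x₂^2 * x₃^6 * y₁^2 * y₃
        + (-2) * x₂^3 * x₃^2 * y₁^2 * y₂^2 * y₃^2 + (-2) * x₂^3 * x₃^2 * y₁^5 * y₃ + x₂^4 * x₃ * y₁^4 * y₂ * y₃ + (-(x₂^4 * x₃^4 * y₁^3))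
        + (-(x₂^5 * y₁ * y₂^2 * y₃^3)) + (-(x₂^5 * x₃^3 * y₁^2 * y₂)) + (-(x₁ * x₃^4 * y₂^3 * y₃^3)) + (-2) * x₁ * x₃^4 * y₁ * y₂ * y₃^4
        + (-6) * x₁ * x₃^4 * y₁^3 * y₂ * y₃^2 + (-(x₁ * x₃^4 * y₁^5 * y₂)) + (-(x₁ * x₃^7 * y₃^3)) + (-4) * x₁ * x₂ * x₃^3 * y₂^2 * y₃^4
        + (4) * x₁ * x₂ * x₃^3 * y₁^2 * y₂^2 * y₃^2 + (4) * x₁ * x₂ * x₃^3 * y₁^3 * y₃^3 + (-4) * x₁ * x₂ * x₃^3 * y₁^5 * y₃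
        + (2) * x₁ * x₂^2 * x₃^2 * y₂^5 * y₃ + (-2) * x₁ * x₂^2 * x₃^2 * y₁^3 * y₂^3 + (-2) * x₁ * x₂^2 * x₃^2 * y₁^4 * y₂ * y₃
        + (-6) * x₁ * x₂^2 * x₃^5 * y₁^3 + (-2) * x₁ * x₂^3 * x₃ * y₁^2 * y₃^4 + (2) * x₁ * x₂^3 * x₃ * y₁^4 * y₃^2 + (-2) * x₁ * x₂^3 * x₃ * y₁^6
        + x₁ * x₂^4 * y₂^3 * y₃^3 + (2) * x₁ * x₂^4 * y₁ * y₂ * y₃^4 + x₁ * x₂^4 * y₁^5 * y₂ + x₁ * x₂^4 * x₃^3 * y₃^3 + (4) * x₁^2 * x₃^3 * y₂^5 * y₃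
        + (4) * x₁^2 * x₃^3 * y₁ * y₂^3 * y₃^2 + (-4) * x₁^2 * x₃^3 * y₁^2 * y₂ * y₃^3 + (-2) * x₁^2 * x₃^3 * y₁^4 * y₂ * y₃ + (-(x₁^2 * x₃^6 * y₁^3))
        + (2) * x₁^2 * x₂ * x₃^2 * y₁ * y₂^2 * y₃^3 + (-4) * x₁^2 * x₂ * x₃^2 * y₁^3 * y₂^2 * y₃ + (4) * x₁^2 * x₂ * x₃^2 * y₁^4 * y₃^2
        + (-6) * x₁^2 * x₂ * x₃^5 * y₁^2 * y₂ + (2) * x₁^2 * x₂^2 * x₃ * y₂^3 * y₃^3 + (-6) * x₁^2 * x₂^2 * x₃ * y₁ * y₂ * y₃^4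
        + (-2) * x₁^2 * x₂^2 * x₃ * y₁^2 * y₂^3 * y₃ + (-8) * x₁^2 * x₂^2 * x₃ * y₁^3 * y₂ * y₃^2 + (2) * x₁^2 * x₂^2 * x₃ * y₁^5 * y₂
        + (2) * x₁^2 * x₂^2 * x₃^4 * y₁ * y₂^2 + (-2) * x₁^2 * x₂^2 * x₃^4 * y₁^2 * y₃ + (-2) * x₁^2 * x₂^3 * y₁ * y₃^5
        + (2) * x₁^2 * x₂^3 * y₁ * y₂^4 * y₃ + (2) * x₁^2 * x₂^3 * y₁^4 * y₂^2 + (-(x₁^2 * x₂^4 * x₃^2 * y₁^3)) + (-2) * x₁^3 * x₃^2 * y₂^3 * y₃^3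
        + x₁^3 * x₃^2 * y₁ * y₂ * y₃^4 + (3) * x₁^3 * x₃^2 * y₁ * y₂^5 + (4) * x₁^3 * x₃^2 * y₁^2 * y₂^3 * y₃ + (2) * x₁^3 * x₃^2 * y₁^3 * y₂ * y₃^2
        + (-(x₁^3 * x₃^2 * y₁^5 * y₂)) + (2) * x₁^3 * x₃^5 * y₃^3 + (4) * x₁^3 * x₂ * x₃ * y₂^6 + (4) * x₁^3 * x₂ * x₃ * y₁ * y₃^5
        + (4) * x₁^3 * x₂ * x₃ * y₁ * y₂^4 * y₃ + (-4) * x₁^3 * x₂ * x₃ * y₁^2 * y₂^2 * y₃^2 + (-8) * x₁^3 * x₂ * x₃ * y₁^3 * y₃^3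
        + (-4) * x₁^3 * x₂ * x₃ * y₁^4 * y₂^2 + (2) * x₁^3 * x₂ * x₃^4 * y₂^3 + (3) * x₁^3 * x₂ * x₃^4 * y₁ * y₂ * y₃ + (4) * x₁^3 * x₂^2 * y₂ * y₃^5
        + (2) * x₁^3 * x₂^2 * y₂^5 * y₃ + (-4) * x₁^3 * x₂^2 * y₁^2 * y₂ * y₃^3 + (-2) * x₁^3 * x₂^2 * y₁^3 * y₂^3 + (-4) * x₁^3 * x₂^2 * y₁^4 * y₂ * y₃
        + (4) * x₁^3 * x₂^2 * x₃^3 * y₂^2 * y₃ + (2) * x₁^3 * x₂^2 * x₃^3 * y₁ * y₃^2 + (-2) * x₁^3 * x₂^3 * x₃^2 * y₁^2 * y₂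
        + (2) * x₁^3 * x₂^4 * x₃ * y₁ * y₂^2 + x₁^3 * x₂^5 * y₁ * y₂ * y₃ + x₁^4 * x₃ * y₂ * y₃^5 + (3) * x₁^4 * x₃ * y₂^5 * y₃
        + (6) * x₁^4 * x₃ * y₁ * y₂^3 * y₃^2 + (-2) * x₁^4 * x₃ * y₁^3 * y₂^3 + (2) * x₁^4 * x₃ * y₁^4 * y₂ * y₃ + (2) * x₁^4 * x₃^4 * y₂^2 * y₃
        + (-2) * x₁^4 * x₃^4 * y₁ * y₃^2 + x₁^4 * x₃^4 * y₁^3 + (2) * x₁^4 * x₂ * y₃^6 + (2) * x₁^4 * x₂ * y₂^4 * y₃^2 + x₁^4 * x₂ * y₁ * y₂^2 * y₃^3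
        + x₁^4 * x₂ * y₁^2 * y₃^4 + (-(x₁^4 * x₂ * y₁^2 * y₂^4)) + (-2) * x₁^4 * x₂ * y₁^3 * y₂^2 * y₃ + (2) * x₁^4 * x₂ * y₁^4 * y₃^2
        + (-(x₁^4 * x₂ * y₁^6)) + (-4) * x₁^4 * x₂ * x₃^3 * y₂ * y₃^2 + x₁^4 * x₂ * x₃^3 * y₁^2 * y₂ + (-4) * x₁^4 * x₂^2 * x₃^2 * y₃^3
        + (2) * x₁^4 * x₂^2 * x₃^2 * y₁ * y₂^2 + (4) * x₁^4 * x₂^2 * x₃^2 * y₁^2 * y₃ + (-2) * x₁^4 * x₂^3 * x₃ * y₁ * y₂ * y₃ + (-(x₁^5 * y₂^3 * y₃^3))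
        + x₁^5 * y₁ * y₂ * y₃^4 + x₁^5 * y₁ * y₂^5 + (-4) * x₁^5 * y₁^2 * y₂^3 * y₃ + (-2) * x₁^5 * y₁^5 * y₂ + (-(x₁^5 * x₃^3 * y₃^3))
        + (2) * x₁^5 * x₂ * x₃^2 * y₁ * y₂ * y₃ + (-4) * x₁^5 * x₂^2 * x₃ * y₂^2 * y₃ + (-2) * x₁^5 * x₂^2 * x₃ * y₁ * y₃^2
        + (6) * x₁^5 * x₂^2 * x₃ * y₁^3 + (-2) * x₁^5 * x₂^3 * y₁^2 * y₂ + (-8) * x₁^6 * x₃^2 * y₂^2 * y₃ + (-4) * x₁^6 * x₃^2 * y₁ * y₃^2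
        + (-3) * x₁^6 * x₃^2 * y₁^3 + (-4) * x₁^6 * x₂ * x₃ * y₂ * y₃^2 + (-4) * x₁^6 * x₂^2 * y₁ * y₂^2 + (4) * x₁^6 * x₂^2 * y₁^2 * y₃
        + (4) * x₁^7 * x₃ * y₁ * y₂^2 + (-2) * x₁^7 * x₂ * y₂^3 + (-5) * x₁^7 * x₂ * y₁ * y₂ * y₃ + (-2) * x₁^8 * y₂^2 * y₃ + (2) * x₁^8 * y₁ * y₃^2
        + (2) * x₁^8 * y₁^3 + (2) * x₃^2 * y₁ * y₂^4 * y₃^3 + (-4) * x₃^2 * y₁^2 * y₂^2 * y₃^4 + (4) * x₃^2 * y₁^3 * y₂^4 * y₃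
        + (-4) * x₃^2 * y₁^4 * y₂^2 * y₃^2 + (2) * x₃^5 * y₁^2 * y₂^3 + x₃^8 * y₁^2 + (-4) * x₂ * x₃ * y₂^5 * y₃^3 + (-2) * x₂ * x₃ * y₁ * y₂^3 * y₃^4
        + (-4) * x₂ * x₃ * y₁^2 * y₂ * y₃^5 + (-4) * x₂ * x₃ * y₁^2 * y₂^5 * y₃ + (4) * x₂ * x₃ * y₁^3 * y₂^3 * y₃^2 + (-8) * x₂ * x₃ * y₁^4 * y₂ * y₃^3
        + (2) * x₂ * x₃ * y₁^5 * y₂^3 + (8) * x₂ * x₃ * y₁^6 * y₂ * y₃ + (6) * x₂ * x₃^4 * y₁ * y₃^4 + (2) * x₂ * x₃^4 * y₁^2 * y₂^2 * y₃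
        + (2) * x₂ * x₃^4 * y₁^3 * y₃^2 + (-(x₂ * x₃^4 * y₁^5)) + (-2) * x₂^2 * y₁ * y₂^2 * y₃^5 + (2) * x₂^2 * y₁ * y₂^6 * y₃
        + (-2) * x₂^2 * y₁^2 * y₂^4 * y₃^2 + (-2) * x₂^2 * y₁^4 * y₃^4 + (4) * x₂^2 * y₁^5 * y₂^2 * y₃ + (2) * x₂^2 * y₁^8
        + (2) * x₂^2 * x₃^3 * y₂ * y₃^4 + (-2) * x₂^2 * x₃^3 * y₂^5 + (2) * x₂^2 * x₃^6 * y₂^2 + (-2) * x₂^3 * x₃^2 * y₁^4 * y₃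
        + (-(x₂^4 * x₃^4 * y₁^2)) + (-(x₂^5 * y₁^5)) + (2) * x₁ * x₃ * y₂^8 + (4) * x₁ * x₃ * y₁ * y₂^6 * y₃ + (2) * x₁ * x₃ * y₁^3 * y₂^2 * y₃^3
        + (2) * x₁ * x₃ * y₁^4 * y₂^4 + (4) * x₁ * x₃ * y₁^5 * y₂^2 * y₃ + (4) * x₁ * x₃^4 * y₂ * y₃^4 + x₁ * x₃^4 * y₁^4 * y₂ + x₁ * x₂ * y₂^3 * y₃^5
        + x₁ * x₂ * y₂^7 * y₃ + (-5) * x₁ * x₂ * y₁ * y₂ * y₃^6 + x₁ * x₂ * y₁ * y₂^5 * y₃^2 + (-6) * x₁ * x₂ * y₁^2 * y₂^3 * y₃^3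
        + (-(x₁ * x₂ * y₁^3 * y₂ * y₃^4)) + (-3) * x₁ * x₂ * y₁^3 * y₂^5 + (7) * x₁ * x₂ * y₁^4 * y₂^3 * y₃ + (-3) * x₁ * x₂ * y₁^5 * y₂ * y₃^2
        + (5) * x₁ * x₂ * y₁^7 * y₂ + (4) * x₁ * x₂ * x₃^3 * y₃^5 + (-4) * x₁ * x₂ * x₃^3 * y₂^4 * y₃ + (4) * x₁ * x₂ * x₃^3 * y₁ * y₂^2 * y₃^2
        + (4) * x₁ * x₂ * x₃^3 * y₁^2 * y₃^3 + (2) * x₁ * x₂^2 * x₃^2 * y₂^3 * y₃^2 + (2) * x₁ * x₂^2 * x₃^2 * y₁ * y₂ * y₃^3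
        + (2) * x₁ * x₂^2 * x₃^2 * y₁^2 * y₂^3 + (-4) * x₁ * x₂^2 * x₃^2 * y₁^3 * y₂ * y₃ + (-6) * x₁ * x₂^2 * x₃^5 * y₁^2
        + (-2) * x₁ * x₂^3 * x₃ * y₁ * y₃^4 + (4) * x₁ * x₂^3 * x₃ * y₁ * y₂^4 + (2) * x₁ * x₂^3 * x₃ * y₁^3 * y₃^2 + (-(x₁ * x₂^4 * y₁^4 * y₂))
        + x₁^2 * y₂^2 * y₃^6 + (-(x₁^2 * y₂^6 * y₃^2)) + (-2) * x₁^2 * y₁ * y₃^7 + (-6) * x₁^2 * y₁^2 * y₂^2 * y₃^4 + (-2) * x₁^2 * y₁^2 * y₂^6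
        + (5) * x₁^2 * y₁^4 * y₂^2 * y₃^2 + (-2) * x₁^2 * y₁^5 * y₃^3 + (4) * x₁^2 * y₁^6 * y₂^2 + (4) * x₁^2 * x₃^3 * y₁ * y₂ * y₃^3
        + (4) * x₁^2 * x₃^3 * y₁^2 * y₂^3 + (-(x₁^2 * x₃^6 * y₁^2)) + (4) * x₁^2 * x₂ * x₃^2 * y₁ * y₃^4 + (4) * x₁^2 * x₂ * x₃^2 * y₁^2 * y₂^2 * y₃
        + (-4) * x₁^2 * x₂ * x₃^2 * y₁^3 * y₃^2 + (-2) * x₁^2 * x₂ * x₃^2 * y₁^5 + (4) * x₁^2 * x₂ * x₃^5 * y₁ * y₂ + (6) * x₁^2 * x₂^2 * x₃ * y₂^5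
        + (2) * x₁^2 * x₂^2 * x₃ * y₁ * y₂^3 * y₃ + (-6) * x₁^2 * x₂^2 * x₃ * y₁^2 * y₂ * y₃^2 + (-2) * x₁^2 * x₂^2 * x₃ * y₁^4 * y₂
        + (2) * x₁^2 * x₂^2 * x₃^4 * y₂^2 + (2) * x₁^2 * x₂^3 * y₁^3 * y₂^2 + (-(x₁^2 * x₂^4 * x₃^2 * y₁^2)) + (4) * x₁^3 * x₃^2 * y₁ * y₂^3 * y₃
        + (2) * x₁^3 * x₃^2 * y₁^4 * y₂ + (6) * x₁^3 * x₂ * x₃ * y₁ * y₂^2 * y₃^2 + (-4) * x₁^3 * x₂ * x₃ * y₁^4 * y₃ + (4) * x₁^3 * x₂ * x₃^4 * y₂ * y₃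
        + (-4) * x₁^3 * x₂^2 * y₂^3 * y₃^2 + (-4) * x₁^3 * x₂^2 * y₁ * y₂ * y₃^3 + (-4) * x₁^3 * x₂^2 * y₁^2 * y₂^3
        + (-6) * x₁^3 * x₂^2 * y₁^3 * y₂ * y₃ + (-2) * x₁^3 * x₂^2 * x₃^3 * y₁^2 + (-2) * x₁^3 * x₂^3 * x₃^2 * y₁ * y₂ + (-6) * x₁^4 * x₃ * y₂^3 * y₃^2
        + (-8) * x₁^4 * x₃ * y₁ * y₂ * y₃^3 + (-2) * x₁^4 * x₃ * y₁^2 * y₂^3 + x₁^4 * x₃^4 * y₁^2 + (-2) * x₁^4 * x₂ * y₂^2 * y₃^3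
        + (-6) * x₁^4 * x₂ * y₁ * y₃^4 + (-4) * x₁^4 * x₂ * y₁ * y₂^4 + (-4) * x₁^4 * x₂ * y₁^2 * y₂^2 * y₃ + (-6) * x₁^4 * x₂ * y₁^3 * y₃^2
        + (-(x₁^4 * x₂ * y₁^5)) + (4) * x₁^4 * x₂ * x₃^3 * y₁ * y₂ + (4) * x₁^4 * x₂^2 * x₃^2 * y₂^2 + (2) * x₁^4 * x₂^2 * x₃^2 * y₁ * y₃
        + (-2) * x₁^5 * y₂ * y₃^4 + (-6) * x₁^5 * y₁ * y₂^3 * y₃ + (-4) * x₁^5 * y₁^2 * y₂ * y₃^2 + (-9) * x₁^5 * y₁^4 * y₂ + (-4) * x₁^5 * x₃^3 * y₂^2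
        + (4) * x₁^5 * x₃^3 * y₁ * y₃ + (4) * x₁^5 * x₂ * x₃^2 * y₂ * y₃ + (-3) * x₁^6 * x₃^2 * y₁^2 + (4) * x₁^6 * x₂ * x₃ * y₁ * y₂
        + (-2) * x₁^6 * x₂^2 * y₂^2 + (2) * x₁^6 * x₂^2 * y₁ * y₃ + (2) * x₁^8 * y₁^2 + (-2) * x₃^2 * y₁^2 * y₂^4 * y₃
        + (-4) * x₃^2 * y₁^3 * y₂^2 * y₃^2 + (-4) * x₂ * x₃ * y₁ * y₂ * y₃^5 + (-8) * x₂ * x₃ * y₁ * y₂^5 * y₃ + (-8) * x₂ * x₃ * y₁^3 * y₂ * y₃^3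
        + (4) * x₂ * x₃ * y₁^4 * y₂^3 + (4) * x₂ * x₃ * y₁^5 * y₂ * y₃ + (2) * x₂ * x₃^4 * y₃^4 + (-2) * x₂ * x₃^4 * y₂^4
        + (-2) * x₂ * x₃^4 * y₁^2 * y₃^2 + (-4) * x₂ * x₃^4 * y₁^4 + (-4) * x₂^2 * y₁ * y₂^4 * y₃^2 + (-2) * x₂^2 * y₁^3 * y₃^4
        + (-2) * x₂^2 * y₁^3 * y₂^4 + (4) * x₂^2 * y₁^4 * y₂^2 * y₃ + (-6) * x₂^2 * y₁^5 * y₃^2 + (2) * x₂^2 * y₁^7 + (-4) * x₂^2 * x₃^3 * y₁^3 * y₂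
        + (-4) * x₂^2 * x₃^6 * y₃ + x₁ * x₃ * y₂^2 * y₃^5 + (3) * x₁ * x₃ * y₂^6 * y₃ + (-2) * x₁ * x₃ * y₁ * y₂^4 * y₃^2
        + (-2) * x₁ * x₃ * y₁^2 * y₂^2 * y₃^3 + (4) * x₁ * x₃ * y₁^3 * y₂^4 + x₁ * x₃ * y₁^4 * y₂^2 * y₃ + (-2) * x₁ * x₃^4 * y₁^3 * y₂
        + (-2) * x₁ * x₂ * y₂ * y₃^6 + (-2) * x₁ * x₂ * y₂^5 * y₃^2 + (-8) * x₁ * x₂ * y₁ * y₂^3 * y₃^3 + (-2) * x₁ * x₂ * y₁^2 * y₂ * y₃^4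
        + (-10) * x₁ * x₂ * y₁^2 * y₂^5 + (4) * x₁ * x₂ * y₁^3 * y₂^3 * y₃ + (-6) * x₁ * x₂ * y₁^4 * y₂ * y₃^2 + (6) * x₁ * x₂ * y₁^6 * y₂
        + (4) * x₁ * x₂ * x₃^3 * y₁ * y₃^3 + (-2) * x₁ * x₂^2 * x₃^2 * y₁ * y₂^3 + (-2) * x₁ * x₂^2 * x₃^2 * y₁^2 * y₂ * y₃
        + (-4) * x₁ * x₂^2 * x₃^5 * y₁ + (-5) * x₁^2 * y₁ * y₂^2 * y₃^4 + (-3) * x₁^2 * y₁ * y₂^6 + (2) * x₁^2 * y₁^2 * y₃^5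
        + (2) * x₁^2 * y₁^2 * y₂^4 * y₃ + (10) * x₁^2 * y₁^3 * y₂^2 * y₃^2 + (3) * x₁^2 * y₁^5 * y₂^2 + (2) * x₁^2 * y₁^6 * y₃
        + (-4) * x₁^2 * x₃^3 * y₁ * y₂^3 + (-4) * x₁^2 * x₃^3 * y₁^2 * y₂ * y₃ + (4) * x₁^2 * x₂ * x₃^2 * y₃^4 + (-4) * x₁^2 * x₂ * x₃^2 * y₂^4
        + (-4) * x₁^2 * x₂ * x₃^2 * y₁^4 + (-2) * x₁^2 * x₂^2 * x₃ * y₂^3 * y₃ + (-2) * x₁^2 * x₂^2 * x₃ * y₁ * y₂ * y₃^2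
        + (-2) * x₁^2 * x₂^2 * x₃ * y₁^3 * y₂ + (-2) * x₁^3 * x₃^2 * y₁ * y₂ * y₃^2 + (2) * x₁^3 * x₃^2 * y₁^3 * y₂ + (4) * x₁^3 * x₃^5 * y₃
        + (4) * x₁^3 * x₂^2 * y₂ * y₃^3 + (-4) * x₁^3 * x₂^2 * y₁ * y₂^3 + (2) * x₁^3 * x₂^2 * y₁^2 * y₂ * y₃ + (-2) * x₁^4 * x₃ * y₂ * y₃^3
        + (-4) * x₁^4 * x₃ * y₁ * y₂^3 + (6) * x₁^4 * x₃ * y₁^2 * y₂ * y₃ + x₁^4 * x₃^4 * y₁ + (2) * x₁^4 * x₂ * y₃^4 + (-8) * x₁^4 * x₂ * y₂^4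
        + (8) * x₁^4 * x₂ * y₁ * y₂^2 * y₃ + (2) * x₁^4 * x₂ * y₁^2 * y₃^2 + (-2) * x₁^4 * x₂^2 * x₃^2 * y₃ + (-(x₁^4 * x₂^4 * y₁))
        + (-4) * x₁^5 * y₂^3 * y₃ + (-2) * x₁^5 * y₁ * y₂ * y₃^2 + (-8) * x₁^5 * y₁^3 * y₂ + (-2) * x₁^6 * x₃^2 * y₁ + (2) * x₁^6 * x₂^2 * y₃
        + x₁^8 * y₁ + (-4) * x₃^2 * y₁ * y₂^4 * y₃ + (-4) * x₂ * x₃ * y₂^5 * y₃ + (4) * x₂ * x₃ * y₁^2 * y₂ * y₃^3 + (2) * x₂ * x₃ * y₁^3 * y₂^3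
        + (2) * x₂ * x₃^4 * y₂^2 * y₃ + (-4) * x₂ * x₃^4 * y₁^3 + (-2) * x₂^2 * y₁^2 * y₂^4 + (-4) * x₂^2 * y₁^4 * y₃^2 + (-4) * x₁ * x₃ * y₂^4 * y₃^2
        + (-4) * x₁ * x₃ * y₁ * y₂^2 * y₃^3 + (4) * x₁ * x₃ * y₁^4 * y₃^2 + (-2) * x₁ * x₂ * y₂^3 * y₃^3 + (-10) * x₁ * x₂ * y₁ * y₂^5
        + (-2) * x₁ * x₂ * y₁^2 * y₂^3 * y₃ + (-8) * x₁ * x₂ * y₁^5 * y₂ + (-4) * x₁ * x₂ * x₃^3 * y₁ * y₂^2 + (-4) * x₁ * x₂^2 * x₃^2 * y₁ * y₂ * y₃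
        + (-4) * x₁ * x₂^2 * x₃^5 + (-(x₁^2 * y₂^2 * y₃^4)) + (-(x₁^2 * y₂^6)) + x₁^2 * y₁ * y₃^5 + x₁^2 * y₁ * y₂^4 * y₃
        + (8) * x₁^2 * y₁^2 * y₂^2 * y₃^2 + (2) * x₁^2 * y₁^3 * y₃^3 + (-3) * x₁^2 * y₁^4 * y₂^2 + (-3) * x₁^2 * y₁^5 * y₃
        + (-4) * x₁^2 * x₂ * x₃^2 * y₂^2 * y₃ + (-4) * x₁^2 * x₂ * x₃^2 * y₁ * y₃^2 + (-4) * x₁^2 * x₂ * x₃^2 * y₁^3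
        + (-4) * x₁^2 * x₂^2 * x₃ * y₂ * y₃^2 + (-4) * x₁^2 * x₂^2 * x₃ * y₁^2 * y₂ + (-4) * x₁^3 * x₃^2 * y₂ * y₃^2 + (-4) * x₁^3 * x₂^2 * y₂^3
        + (-2) * x₁^3 * x₂^2 * y₁ * y₂ * y₃ + (-4) * x₁^4 * x₃ * y₂^3 + (-(x₁^4 * x₃^4)) + (4) * x₁^4 * x₂ * y₂^2 * y₃ + (4) * x₁^4 * x₂ * y₁^3
        + x₁^4 * x₂^4 + (-4) * x₁^5 * y₁^2 * y₂ + (-2) * x₁^6 * x₃^2 + (4) * x₂ * x₃ * y₂^3 * y₃^2 + (-2) * x₂^2 * y₁ * y₂^4 + (-2) * x₂^2 * y₁^3 * y₃^2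
        + (-2) * x₁ * x₃ * y₂^2 * y₃^3 + (2) * x₁ * x₃ * y₁^2 * y₂^2 * y₃ + x₁ * x₂ * y₂ * y₃^4 + (-(x₁ * x₂ * y₂^5)) + (2) * x₁ * x₂ * y₁ * y₂^3 * y₃
        + (2) * x₁ * x₂ * y₁^2 * y₂ * y₃^2 + (-7) * x₁ * x₂ * y₁^4 * y₂ + (2) * x₁ * x₂^2 * x₃^2 * y₂ * y₃ + (-2) * x₁^2 * y₃^5 + (6) * x₁^2 * y₂^4 * y₃
        + (-2) * x₁^2 * y₁ * y₂^2 * y₃^2 + (-2) * x₁^2 * y₁^3 * y₂^2 + (-2) * x₁^2 * y₁^4 * y₃ + (-4) * x₁^2 * x₂ * x₃^2 * y₁^2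
        + (-4) * x₁^2 * x₂^2 * x₃ * y₁ * y₂ + (-4) * x₁^3 * x₃^2 * y₁ * y₂ + (-4) * x₁^3 * x₂ * x₃ * y₂^2 + (-8) * x₁^3 * x₂ * x₃ * y₁ * y₃
        + (-4) * x₁^3 * x₂^2 * y₂ * y₃ + (4) * x₁^4 * x₃ * y₂ * y₃ + (-4) * x₁^5 * y₁ * y₂ + (4) * x₂ * x₃ * y₁^2 * y₂ * y₃
        + (2) * x₂^2 * y₁ * y₂^2 * y₃ + (-2) * x₂^2 * x₃^3 * y₂ + (4) * x₁ * x₂ * y₂^3 * y₃ + (-2) * x₁^2 * y₂^2 * y₃^2 + (2) * x₁^2 * y₁ * y₃^3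
        + (2) * x₁^2 * y₁^2 * y₂^2 + (-2) * x₁^2 * y₁^3 * y₃ + (-4) * x₁^2 * x₂ * x₃^2 * y₁ + (-2) * x₁^2 * x₂^2 * x₃ * y₂ + (-4) * x₁^3 * x₂ * x₃ * y₃
        + (-4) * x₁^4 * x₂ * y₁ + (4) * x₂ * x₃ * y₁ * y₂ * y₃ + (-2) * x₂ * x₃^4 + (-2) * x₁ * x₂ * y₂ * y₃^2 + (6) * x₁ * x₂ * y₁^2 * y₂
        + (-2) * x₁ * x₂^3 * x₃ + (4) * x₁^2 * y₁ * y₂^2 + (-2) * x₁^4 * x₂ + (4) * x₂ * x₃ * y₂ * y₃ + (2) * x₂^2 * y₃^2 + (2) * x₂^2 * y₁^2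
        + (8) * x₁ * x₂ * y₁ * y₂ + (2) * x₁^2 * y₂^2 + (4) * x₂^2 * y₁ + (4) * x₁ * x₂ * y₂ + (2) * x₂^2) * h5

/-! ### The upper bound in characteristic 5 -/

/-- THEOREM M5 AT ITS EXCEPTIONAL PRIME, N = 12, p = 5: in a commutative ring with `5 = 0`, the nine slice equations at
`P₀ = z¹² − 1` in μ₄-eigencoordinates force `x₀ = 0`, `y₀ = 0`, `x₁⁸ = 0` (length ≤ 8 by Nakayama on the seven linear
parts, `4 = −1` being a unit; length ≥ 8 is (iii) of `ZeroSumQuintuplePointN12.lean`). -/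
theorem x1_pow_eight_eq_zero (x₀ x₁ x₂ x₃ y₀ y₁ y₂ y₃ : R) (h5 : (5 : R) = 0)
    (F10 : (4) * x₀ = 0)
    (F9 : (4) * y₀ = 0)
    (F8 : (-2) * x₂^2 + (-4) * x₁ * x₃ + (6) * x₀^2 = 0)
    (F7 : (-4) * x₃ * y₁ + (-4) * x₂ * y₂ + (-4) * x₁ * y₃ + (12) * x₀ * y₀ + (-4) * x₃ = 0)
    (F6 : (4) * x₂ * x₃^2 + (4) * x₁^2 * x₂ + (-4) * x₀ * x₂^2 + (-8) * x₀ * x₁ * x₃ + (4) * x₀^3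
      + (-2) * y₂^2 + (-4) * y₁ * y₃ + (6) * y₀^2 + (-4) * y₃ = 0)
    (F5 : (4) * x₃^2 * y₂ + (8) * x₂ * x₃ * y₃ + (-4) * x₂^2 * y₀ + (-8) * x₁ * x₃ * y₀
      + (8) * x₁ * x₂ * y₁ + (4) * x₁^2 * y₂ + (-8) * x₀ * x₃ * y₁ + (-8) * x₀ * x₂ * y₂
      + (-8) * x₀ * x₁ * y₃ + (12) * x₀^2 * y₀ + (8) * x₁ * x₂ + (-8) * x₀ * x₃ = 0)
    (F4 : (-(x₃^4)) + x₂^4 + (-4) * x₁ * x₂^2 * x₃ + (2) * x₁^2 * x₃^2 + (-(x₁^4))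
      + (4) * x₀ * x₂ * x₃^2 + (4) * x₀ * x₁^2 * x₂ + (-2) * x₀^2 * x₂^2 + (-4) * x₀^2 * x₁ * x₃
      + x₀^4 + (8) * x₃ * y₂ * y₃ + (-8) * x₃ * y₀ * y₁ + (4) * x₂ * y₃^2 + (4) * x₂ * y₁^2
      + (-8) * x₂ * y₀ * y₂ + (8) * x₁ * y₁ * y₂ + (-8) * x₁ * y₀ * y₃ + (-4) * x₀ * y₂^2
      + (-8) * x₀ * y₁ * y₃ + (12) * x₀ * y₀^2 + (-8) * x₃ * y₀ + (8) * x₂ * y₁ + (8) * x₁ * y₂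
      + (-8) * x₀ * y₃ + (4) * x₂ = 0)
    (F3 : (-4) * x₃^3 * y₃ + (4) * x₂ * x₃^2 * y₀ + (-4) * x₂^2 * x₃ * y₁ + (4) * x₂^3 * y₂
      + (4) * x₁ * x₃^2 * y₁ + (-8) * x₁ * x₂ * x₃ * y₂ + (-4) * x₁ * x₂^2 * y₃ + (4) * x₁^2 * x₃ * y₃
      + (4) * x₁^2 * x₂ * y₀ + (-4) * x₁^3 * y₁ + (4) * x₀ * x₃^2 * y₂ + (8) * x₀ * x₂ * x₃ * y₃
      + (-4) * x₀ * x₂^2 * y₀ + (-8) * x₀ * x₁ * x₃ * y₀ + (8) * x₀ * x₁ * x₂ * y₁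
      + (4) * x₀ * x₁^2 * y₂ + (-4) * x₀^2 * x₃ * y₁ + (-4) * x₀^2 * x₂ * y₂ + (-4) * x₀^2 * x₁ * y₃
      + (4) * x₀^3 * y₀ + (4) * y₂ * y₃^2 + (4) * y₁^2 * y₂ + (-4) * y₀ * y₂^2 + (-8) * y₀ * y₁ * y₃
      + (4) * y₀^3 + (-4) * x₂^2 * x₃ + (4) * x₁ * x₃^2 + (-4) * x₁^3 + (8) * x₀ * x₁ * x₂
      + (-4) * x₀^2 * x₃ + (8) * y₁ * y₂ + (-8) * y₀ * y₃ + (4) * y₂ = 0)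
    (F0 : (-(y₃^4)) + y₂^4 + (-4) * y₁ * y₂^2 * y₃ + (2) * y₁^2 * y₃^2 + (-(y₁^4))
      + (4) * y₀ * y₂ * y₃^2 + (4) * y₀ * y₁^2 * y₂ + (-2) * y₀^2 * y₂^2 + (-4) * y₀^2 * y₁ * y₃
      + y₀^4 + (-4) * y₂^2 * y₃ + (4) * y₁ * y₃^2 + (-4) * y₁^3 + (8) * y₀ * y₁ * y₂
      + (-4) * y₀^2 * y₃ + (2) * y₃^2 + (-6) * y₁^2 + (4) * y₀ * y₂ + (-4) * y₁ = 0) :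
    x₀ = 0 ∧ y₀ = 0 ∧ x₁ ^ 8 = 0 := by
  have hx0 : x₀ = 0 := by linear_combination (4 : R) * F10 - (3 * x₀) * h5
  have hy0 : y₀ = 0 := by linear_combination (4 : R) * F9 - (3 * y₀) * h5
  subst hx0 hy0
  refine ⟨rfl, rfl, ?_⟩

  have G8 : (-2) * x₂^2 + (-4) * x₁ * x₃ = 0 := by
    linear_combination F8
  have G7 : (-4) * x₃ * y₁ + (-4) * x₂ * y₂ + (-4) * x₁ * y₃ + (-4) * x₃ = 0 := by
    linear_combination F7
  have G6 : (4) * x₂ * x₃^2 + (4) * x₁^2 * x₂ + (-2) * y₂^2 + (-4) * y₁ * y₃ + (-4) * y₃ = 0 := by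
    linear_combination F6
  have G5 : (4) * x₃^2 * y₂ + (8) * x₂ * x₃ * y₃ + (8) * x₁ * x₂ * y₁ + (4) * x₁^2 * y₂ + (8) * x₁ * x₂ = 0 := by
    linear_combination F5
  have G4 : (-(x₃^4)) + x₂^4 + (-4) * x₁ * x₂^2 * x₃ + (2) * x₁^2 * x₃^2 + (-(x₁^4)) + (8) * x₃ * y₂ * y₃
      + (4) * x₂ * y₃^2 + (4) * x₂ * y₁^2 + (8) * x₁ * y₁ * y₂ + (8) * x₂ * y₁ + (8) * x₁ * y₂
      + (4) * x₂ = 0 := by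
    linear_combination F4
  have G3 : (-4) * x₃^3 * y₃ + (-4) * x₂^2 * x₃ * y₁ + (4) * x₂^3 * y₂ + (4) * x₁ * x₃^2 * y₁
      + (-8) * x₁ * x₂ * x₃ * y₂ + (-4) * x₁ * x₂^2 * y₃ + (4) * x₁^2 * x₃ * y₃ + (-4) * x₁^3 * y₁
      + (4) * y₂ * y₃^2 + (4) * y₁^2 * y₂ + (-4) * x₂^2 * x₃ + (4) * x₁ * x₃^2 + (-4) * x₁^3
      + (8) * y₁ * y₂ + (4) * y₂ = 0 := by
    linear_combination F3
  have G0 : (-(y₃^4)) + y₂^4 + (-4) * y₁ * y₂^2 * y₃ + (2) * y₁^2 * y₃^2 + (-(y₁^4)) + (-4) * y₂^2 * y₃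
      + (4) * y₁ * y₃^2 + (-4) * y₁^3 + (2) * y₃^2 + (-6) * y₁^2 + (-4) * y₁ = 0 := by
    linear_combination F0

  exact cert_char_five x₁ x₂ x₃ y₁ y₂ y₃ h5 G8 G7 G6 G5 G4 G3 G0

/-- The two constants behind the prime 5 at N = 12 (arithmetic; `W3-M5-EXCEPTIONAL` §3′): `c(12) = −5/6144` is divisible
by 5 and `d₈(12) = −59/2²¹` is a 5-adic unit — numerators `5` and `59`. -/
theorem c12_and_d8_12 :
    -(((12 : ℚ) - 3) * (12 - 6) * (12 ^ 2 - 6 * 12 + 3)) / (20 * 12 ^ 5) = -5 / 6144 ∧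
    -(((12 : ℚ) - 3) * (12 - 6) * (12 - 9) * (2 * 12 - 9) * (35 * 12 ^ 3 - 318 * 12 ^ 2 + 657 * 12 - 270))
      / (4480 * 12 ^ 8) = -59 / 2097152 := by
  constructor <;> norm_num

end ZeroSumQuintuplePointN12CharFive

end Summit.Ventures.HSemireg
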